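import Summits.BirchSwinnertonDyer.BirchSwinnertonDyer.Theses.ByReductionTypeAtTwo
import Literature.NumberTheory.EllipticCurves.GaloisAction
import Literature.NumberTheory.EllipticCurves.QuadraticTwist
import HarnessLib

/-!
# Sketch — crux idea `dihedral-prime-two-disc-field` for `OrdMissingLowerBoundAtTwo` (stmt-BirchSwinnertonDyer-19577)

First-lemma signatures (Props) and two PROVED pieces of bookkeeping (the pair door and the
restriction of the crux); nothing else is claimed and BSD is not proved by any of this.

The line: for `E/ℚ` good ordinary at 2 with `E[2]` irreducible (image `S₃`), `p = 2` is a
*dihedral prime*: over the discriminant field `K_E = ℚ(√Δ_E)` one has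
`ρ̄_{E,2} ⊗ 𝔽₄ |_{G_{K_E}} ≅ ψ ⊕ ψ̄` with `ψ` the order-3 ring-class character cutting out
`ℚ(E[2]) / K_E` — an EISENSTEIN situation over `𝔽₄`, split (3 is invertible mod 2).
SPLIT TYPE at 2 (`Δ_E ∈ ℚ₂^{×2}`, equivalently `E[2] ⊆ E(ℚ₂)`, equivalently 2 splits in `K_E`)
is exactly where the Hecke-side (multiplicity-one) roads are unavailable; there the proposed input
is the two-variable (`ℤ₂²`) main conjecture for `E / K_E`, anchored on Rubin–Johnson-Leung–Kings'
two-variable GL₁ main conjecture over `K_E` at `p = 2` through the residual splitting, descended to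
`ℚ` as a PAIR statement for `(E, E^{(d_K)})` and separated with Kato's bound for the partner.
-/

set_option linter.dupNamespace false

namespace Summit.BirchSwinnertonDyer.BirchSwinnertonDyer.Cruxes.OrdMissingLowerBoundAtTwo.DihedralPrimeTwo

open Literature.NumberTheory.EllipticCurves.Rank1Residual (GoodOrd)
open Literature.NumberTheory.EllipticCurves.Rank1Residual.Typed
  (MissingLowerBoundAt MissingUpperBoundAt)
open WeierstrassCurve Literature.NumberTheory.EllipticCurves

/-- The split-dihedral habitat `H_sd`: `E[2]` irreducible (image `S₃`), `Δ < 0` (so `K_E = ℚ(√Δ)`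
is imaginary quadratic) and `Δ ∈ ℚ₂^{×2}` (split type: 2 splits in `K_E`, `E[2] ⊆ E(ℚ₂)`).
It is the exact complement, inside «irreducible, `Δ < 0`», of the weight-one habitat `ThetaHabitat`
of the card `theta-anchor-two` (lemma `thetaHabitat_iff_not_splitDihedral` below). -/
def SplitDihedralHabitat (W : WeierstrassCurve ℚ) [W.IsElliptic] : Prop :=
  W.HasIrreducibleModPGaloisRep 2 ∧ W.Δ < 0 ∧ IsSquare (algebraMap ℚ ℚ_[2] W.Δ)

/-- `theta-anchor-two`'s weight-one habitat, restated VERBATIM from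
`Cruxes/OrdMissingLowerBoundAtTwo/SketchThetaAnchorTwo.lean` (`ThetaAnchor.ThetaHabitat`; that
module is not imported here only to keep this sketch independently buildable). -/
def ThetaHabitat' (W : WeierstrassCurve ℚ) [W.IsElliptic] : Prop :=
  W.HasIrreducibleModPGaloisRep 2 ∧ W.Δ < 0 ∧ ¬ IsSquare (algebraMap ℚ ℚ_[2] W.Δ)

/-- Split type at 2, restated verbatim from the same file (`ThetaAnchor.SplitTypeAtTwo`):
the 2-division cubic splits over `ℚ₂`, i.e. `E[2] ⊆ E(ℚ₂)`. -/
def SplitTypeAtTwo' (W : WeierstrassCurve ℚ) : Prop :=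
  (W.twoTorsionPolynomial.toPoly.map (algebraMap ℚ ℚ_[2])).Splits

/-- Complementarity with `theta-anchor-two`'s habitat (bookkeeping, proved): inside
«`E[2]` irreducible, `Δ < 0`» the two habitats are exact complements. -/
theorem thetaHabitat_iff_not_splitDihedral (W : WeierstrassCurve ℚ) [W.IsElliptic]
    (hirr : W.HasIrreducibleModPGaloisRep 2) (hΔ : W.Δ < 0) :
    ThetaHabitat' W ↔ ¬ SplitDihedralHabitat W := by
  unfold ThetaHabitat' SplitDihedralHabitat
  constructor
  · rintro ⟨-, -, hns⟩ ⟨-, -, hs⟩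
    exact hns hs
  · intro h
    exact ⟨hirr, hΔ, fun hs => h ⟨hirr, hΔ, hs⟩⟩

/-- FIRST LEMMA (L1, the Eisenstein hinge). If the 2-division cubic of `W` is irreducible over `ℚ`
(equivalently `E[2]` is an irreducible `𝔽₂[G_ℚ]`-module), then over any quadratic field `K` in
which `Δ_W` becomes a square — i.e. over the discriminant field `K_E = ℚ(√Δ)` — the cubic stays
irreducible with Galois group of order 3: `Gal(K(E[2])/K) ≅ A₃ = C₃`, so that
`ρ̄_{E,2}|_{G_K} ⊗ 𝔽₄ = ψ ⊕ ψ²` for an order-3 character `ψ`. (disc of the cubic is `16 Δ`,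
`WeierstrassCurve.twoTorsionPolynomial_disc`; an irreducible cubic stays irreducible over a
quadratic extension; square discriminant ⇒ Galois group inside `A₃`.) -/
def DiscFieldCubicGalCardThree : Prop :=
  ∀ (W : WeierstrassCurve ℚ) [W.IsElliptic], Irreducible W.twoTorsionPolynomial.toPoly →
    ∀ (K : Type) [Field K] [CharZero K], Module.finrank ℚ K = 2 →
      IsSquare (algebraMap ℚ K W.Δ) →
        Nat.card (W.twoTorsionPolynomial.toPoly.map (algebraMap ℚ K)).Gal = 3

/-- (L1') Dictionary between the tree's predicate and the cubic: `E[2]` irreducible iff the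
2-division cubic has no rational root iff it is irreducible over `ℚ`. Statement only. -/
def IrreducibleTwoIffCubicIrreducible : Prop :=
  ∀ (W : WeierstrassCurve ℚ) [W.IsElliptic],
    W.HasIrreducibleModPGaloisRep 2 ↔ Irreducible W.twoTorsionPolynomial.toPoly

/-- (L2) In the habitat the decomposition group at 2 acts TRIVIALLY on `E[2]` (good ordinary ⇒
`ρ̄(D₂)` unipotent of order ≤ 2; split type ⇒ `D₂ ≤ G_{K_E}` whose image is `C₃`; hence trivial):
the 2-division cubic has three roots in `ℚ₂`. Census: 44/44 habitat classes (kit job j305952,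
column `div2poly_roots_Q2 = 3`). One direction of `ThetaAnchor.SplitTypeIffIsSquareDisc`. -/
def HabitatLocallyTrivialAtTwo : Prop :=
  ∀ (W : WeierstrassCurve ℚ) [W.IsElliptic] [W.IsGloballyMinimal],
    GoodOrd W 2 → SplitDihedralHabitat W → SplitTypeAtTwo' W

/-- `Wd` is a (globally minimal) model of the twist of `W` by ITS OWN discriminant field
`K_E = ℚ(√Δ_W) = ℚ(√d)`, `d` squarefree, `d ≠ 1`. -/
def IsDiscFieldTwist (W Wd : WeierstrassCurve ℚ) : Prop :=
  ∃ d : ℤ, Squarefree d ∧ d ≠ 1 ∧ IsSquare ((d : ℚ) * W.Δ) ∧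
    ∃ C : WeierstrassCurve.VariableChange ℚ, C • W.quadraticTwist (d : ℚ) = Wd

/-- PAIR CURRENCY. The lower `p`-part bound for the PAIR `(E, E^{(d)})` — what a main conjecture
for `E` over the quadratic field `K = ℚ(√d)` delivers at `ℚ`-level after Weil-restriction
bookkeeping (`L(E/K,s) = L(E,s) L(E^{(d)},s)`, `Ш(E/K)[p^∞]` vs `Ш(E)[p^∞] ⊕ Ш(E^{(d)})[p^∞]`
controlled when `E(K)[p] = 0`, which holds in the habitat since `E[2]` needs the cubic field):
`ord_p (#Ш_an(E) · #Ш_an(E^{(d)})) ≤ ord_p (#Ш(E) · #Ш(E^{(d)}))`. -/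
def JointLowerBoundAt (W Wd : WeierstrassCurve ℚ) (p : ℕ) : Prop :=
  ∃ q q' : ℚ, shaAn W = (q : ℂ) ∧ shaAn Wd = (q' : ℂ) ∧
    padicValRat p q + padicValRat p q' ≤
      ((padicValNat p W.shaOrder : ℤ) + (padicValNat p Wd.shaOrder : ℤ))

/-- THE DOOR (proved): the pair lower bound for `(E, E^{(d)})` and the Euler-system UPPER bound
for the partner `E^{(d)}` give the crux's conclusion for `E`. Valuation arithmetic only. -/
theorem missingLowerBoundAt_of_joint_of_upper (W Wd : WeierstrassCurve ℚ) (p : ℕ)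
    (hJ : JointLowerBoundAt W Wd p) (hU : MissingUpperBoundAt Wd p) :
    MissingLowerBoundAt W p := by
  obtain ⟨q, q', hq, hq', hle⟩ := hJ
  obtain ⟨q'', hq'', hge⟩ := hU
  have hqq : q'' = q' := by exact_mod_cast hq''.symm.trans hq'
  subst hqq
  exact ⟨q, hq, by omega⟩

/-- The Euler-system half for the partner, in Miller's currency, on the class «non-CM, analytic
rank 0, good ordinary at 2, `E[2]` irreducible»: the OUTPUT of crux 19573 (`OrdKatoHalfAtTwoIso`,
Kato's divisibility at 2) after the route's control step; on the irreducible stratum there are no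
2-isogenies, so the isogenous model in 19573 changes nothing 2-adically. Input BY NAME, not
claimed. -/
def KatoUpperHalfRankZeroIrredAtTwo : Prop :=
  ∀ (W : WeierstrassCurve ℚ) [W.IsElliptic] [W.IsGloballyMinimal],
    ¬ W.HasCM → W.analyticRank = 0 → GoodOrd W 2 → W.HasIrreducibleModPGaloisRep 2 →
      MissingUpperBoundAt W 2

/-- THE LINE'S TARGET (what the two-variable Eisenstein descent over `K_E` must deliver, projected
to `ℚ`), on the DEFINITE sub-habitat `r_an(E^{(d_K)}) = 0` (22 of the 44 open habitat classes,
j305952): the pair lower bound at 2 for `(E, E^{(d_K)})`. Research-grade; NOT in print at any `p`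
for residually dihedral `E` with `ψ|_{G_v} = 1` (Burungale–Skinner «dihedral primes», odd `p`,
announced in arXiv:2405.00270 Rem. 1.2.3, is the nearest programme). -/
def DiscFieldJointLowerBoundAtTwo : Prop :=
  ∀ (W Wd : WeierstrassCurve ℚ) [W.IsElliptic] [W.IsGloballyMinimal] [Wd.IsElliptic]
    [Wd.IsGloballyMinimal],
    SplitDihedralHabitat W → IsDiscFieldTwist W Wd → ¬ W.HasCM → GoodOrd W 2 →
      W.analyticRank = 0 → Wd.analyticRank = 0 → JointLowerBoundAt W Wd 2

/-- The crux restricted to the definite split-dihedral sub-habitat, with the partner's routine side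
conditions (`E^{(d_K)}` is again non-CM, good ordinary at 2 as `d_K ≡ 1 (mod 8)`, with the same
`ρ̄` mod 2) kept as explicit hypotheses. -/
def OrdMissingLowerBoundAtTwoOnDefiniteSplitDihedral : Prop :=
  ∀ (W Wd : WeierstrassCurve ℚ) [W.IsElliptic] [W.IsGloballyMinimal] [Wd.IsElliptic]
    [Wd.IsGloballyMinimal],
    SplitDihedralHabitat W → IsDiscFieldTwist W Wd → ¬ W.HasCM → GoodOrd W 2 →
      W.analyticRank = 0 → ¬ Wd.HasCM → GoodOrd Wd 2 → Wd.HasIrreducibleModPGaloisRep 2 →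
        Wd.analyticRank = 0 → MissingLowerBoundAt W 2

/-- COMPOSITION (proved): pair lower bound over the discriminant field + Kato's half for the
partner ⇒ the crux on the definite split-dihedral sub-habitat. -/
theorem onDefiniteSplitDihedral_of (hJ : DiscFieldJointLowerBoundAtTwo)
    (hK : KatoUpperHalfRankZeroIrredAtTwo) :
    OrdMissingLowerBoundAtTwoOnDefiniteSplitDihedral := by
  intro W Wd _ _ _ _ hH hT hCM hG hr hCMd hGd hirrd hrd
  exact missingLowerBoundAt_of_joint_of_upper W Wd 2 (hJ W Wd hH hT hCM hG hr hrd)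
    (hK Wd hCMd hrd hGd hirrd)

/-- Sanity (proved): the sub-habitat statement is a restriction of the crux, so closing it is an
honest partial result toward 19577 and nothing here proves BSD. -/
theorem onDefiniteSplitDihedral_of_crux
    (h : Theses.ByReductionTypeAtTwo.OrdMissingLowerBoundAtTwo) :
    OrdMissingLowerBoundAtTwoOnDefiniteSplitDihedral :=
  fun W _ _ _ _ _ _ _ hCM hG hr _ _ _ _ => h W hCM hr hG

end Summit.BirchSwinnertonDyer.BirchSwinnertonDyer.Cruxes.OrdMissingLowerBoundAtTwo.DihedralPrimeTwo
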